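import Summits.QuantumFields.YangMills.Theorems.AllWindowsColdBoxBoxHighLineTiltSupBoundsWilson
import Summits.QuantumFields.YangMills.Theorems.AllWindowsColdBoxBoxHighLinePhiTaylor
import Summits.QuantumFields.YangMills.Theorems.AllWindowsColdBoxBoxHighLineHaarTaylor
import Summits.QuantumFields.YangMills.Theorems.AllWindowsColdBoxBoxHighLineSmallFieldInsideFPCore

/-!
# T-S5.13s (part 2) — ASSEMBLY-S5 §5 SUP BOUNDS ON THE SMALL-FIELD BOX: gauge-fixing, Haar and ghost pieces, and the package `sup_D |tiltU|`
# (planner ym-idea-2 g18, `Cruxes/BoxHighWindowsSU22/ASSEMBLY-S5.md` §5, routing 20:15:08Z «13s = YES, yours»; letters of ✓`…Step2Tilt`;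
# LINE-19 S5 ⟨stmt-QuantumFields-24004⟩/⟨24335⟩, LINE-20 U5 ⟨24336⟩)

Width seat `ym-line-sfw-p2-w4` (prover-ym-line-sfw-p2-w4-g28-0).  Continues ✓/⧗`…TiltSupBoundsWilson` (the Wilson pieces).  On `a ∈ smallField H s`:

* `TiltSup.abs_landauPhi_sub_divLinSq_le` — UNCONDITIONALLY (✓T-S5.7b `phiTaylor` middle clause): `|landauPhi(U(a)) − divLinSq| ≤ C_Φ·H⁴·s⁴`, `C_Φ = 1024·max(C,0)`
  (`Σ_e |g_xe|‖a_e‖² ≤ 8s²` at every interior site ✓`PhiTaylorProof.sum_abs_gradVec_mul`, `#interiorSites ≤ 16H⁴`);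
* `TiltSup.abs_haarLogRatio_le` — UNCONDITIONALLY (✓T-S5.7c `haarTaylor`): `|haarLogRatio| ≤ |LandauFree H|·(s²/3 + C·s⁴)`, `0 ≤ s ≤ 1`;
* `TiltSup.abs_quadVal_le` — Cauchy–Schwarz, any matrix: `|quadVal M a| ≤ √(Σ M²)·Σ_e ‖a_e‖²`; and, GIVEN T-S5.7d `GhostTaylor` as a hypothesis (verbatim),
  `TiltSup.abs_ghostLogRatio_le_of`: `|ghostLogRatio| ≤ C_g·(1+log H)^m·H⁶·(s² + s³)` on `s·H² ≤ c₀` (`C_g = max(C,0) + 216√max(C,0)`);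
* **`TiltSup.abs_tiltU_le_of (h7d : GhostTaylor)`** — the package: `∃ C c₀ m, 0 < c₀ ∧ ∀ H ≥ 1, ∀ β s, 0 ≤ s ≤ 1, s·H² ≤ c₀ → ∀ a ∈ smallField H s,
  |tiltU β H a| ≤ C·(1+log H)^m·(|β|·H⁴·s³ + H⁶·s²)` — in the assembly `|β|H⁴s³ = β^{4θ−1/2+3κ₃} → 0` and `H⁶s² = β^{6θ−1+2κ₃} → 0`, so `sup_D |U| ≤ 1`
  for `β ≥ β₀` (§5).  Only 7d is a hypothesis: 7a is NOT needed for the sup bound (the odd parts cancel inside `cubicVertex + quarticWilson`).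

Everything proved; no definitions; standard axioms.  HONEST LABEL: helper lemmas for the OPEN assembly T-S5.13 of the XL stub S5 (`stub_landauSecondOrder`) of a
critic-PASSed DRAFT line; S5, U5, ⟨24004⟩ ⟨24335⟩ ⟨24336⟩ remain OPEN; no crux, rung or summit is proved; the Yang–Mills mass gap is NOT proved by this file.
-/

set_option autoImplicit false

open MeasureTheory Real Finset Matrix
open Literature.Probability.LatticeModels (Site)
open Literature.MathematicalPhysics.QuantumFieldTheory.AxialGauge (boxEdges)
open Literature.MathematicalPhysics.QuantumFieldTheory.Balaban1983to89.B10Eq22Rescaling (sigmaSU2)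
open Literature.MathematicalPhysics.QuantumLattice (ZdPlaquette plaquettesTouching)

namespace Summit.QuantumFields.YangMills.Theorems.AllWindowsColdBoxBoxHighLine

namespace TiltSup

variable {H : ℕ}

/-! ## The gauge-fixing part (✓T-S5.7b), unconditionally -/

/-- At an interior site, `Σ_e |g_xe|·‖a_e‖² ≤ 8·s²` on `smallField H s` (four in-edges and four out-edges). -/
theorem sum_abs_gradVec_mul_norm_sq_le {x : Site 4} (hx : x ∈ interiorSites H) {s : ℝ} {a : LandauFree H → E3}
    (ha : a ∈ smallField H s) : ∑ e : LandauFree H, |gradVec H x e| * ‖a e‖ ^ 2 ≤ 8 * s ^ 2 := by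
  rw [PhiTaylorProof.sum_abs_gradVec_mul hx]
  have h1 : ∑ μ : Fin 4, ‖a (inEdge hx μ)‖ ^ 2 ≤ 4 * s ^ 2 := by
    calc ∑ μ : Fin 4, ‖a (inEdge hx μ)‖ ^ 2 ≤ ∑ _μ : Fin 4, s ^ 2 :=
          Finset.sum_le_sum fun μ _ => pow_le_pow_left₀ (norm_nonneg _) (ha _) 2
      _ = 4 * s ^ 2 := by simp
  have h2 : ∑ μ : Fin 4, ‖a (outEdge hx μ)‖ ^ 2 ≤ 4 * s ^ 2 := by
    calc ∑ μ : Fin 4, ‖a (outEdge hx μ)‖ ^ 2 ≤ ∑ _μ : Fin 4, s ^ 2 :=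
          Finset.sum_le_sum fun μ _ => pow_le_pow_left₀ (norm_nonneg _) (ha _) 2
      _ = 4 * s ^ 2 := by simp
  linarith

/-- **`|landauPhi(U(a)) − divLinSq H a| ≤ C_Φ·H⁴·s⁴` on `smallField H s`, `H ≥ 1`, unconditionally** (✓T-S5.7b `phiTaylor` middle clause:
`≤ C·Σ_{x interior}(Σ_e|g_xe|‖a_e‖²)²`, `≤ C·16H⁴·64s⁴`; `C_Φ = 1024·max(C,0)`). -/
theorem abs_landauPhi_sub_divLinSq_le : ∃ C : ℝ, 0 ≤ C ∧ ∀ H : ℕ, 1 ≤ H → ∀ s : ℝ, ∀ a ∈ smallField H s,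
    |landauPhi H (edgeChart H a) - divLinSq H a| ≤ C * (H : ℝ) ^ 4 * s ^ 4 := by
  obtain ⟨C, hC⟩ := phiTaylor
  refine ⟨1024 * max C 0, by positivity, fun H hH s a ha => ?_⟩
  have h := (hC H hH a).2.1
  have hsite : ∀ x ∈ interiorSites H, (∑ e : LandauFree H, |gradVec H x e| * ‖a e‖ ^ 2) ^ 2 ≤ 64 * s ^ 4 := by
    intro x hx
    have h8 := sum_abs_gradVec_mul_norm_sq_le hx ha
    have h0 : 0 ≤ ∑ e : LandauFree H, |gradVec H x e| * ‖a e‖ ^ 2 :=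
      Finset.sum_nonneg fun e _ => mul_nonneg (abs_nonneg _) (sq_nonneg _)
    nlinarith
  have hsum : ∑ x ∈ interiorSites H, (∑ e : LandauFree H, |gradVec H x e| * ‖a e‖ ^ 2) ^ 2 ≤ 16 * (H : ℝ) ^ 4 * (64 * s ^ 4) := by
    calc ∑ x ∈ interiorSites H, (∑ e : LandauFree H, |gradVec H x e| * ‖a e‖ ^ 2) ^ 2
        ≤ ∑ _x ∈ interiorSites H, 64 * s ^ 4 := Finset.sum_le_sum hsite
      _ = (interiorSites H).card * (64 * s ^ 4) := by rw [Finset.sum_const, nsmul_eq_mul]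
      _ ≤ 16 * (H : ℝ) ^ 4 * (64 * s ^ 4) :=
          mul_le_mul_of_nonneg_right (PhiTaylorProof.card_interiorSites_le H) (by positivity)
  have hS0 : 0 ≤ ∑ x ∈ interiorSites H, (∑ e : LandauFree H, |gradVec H x e| * ‖a e‖ ^ 2) ^ 2 :=
    Finset.sum_nonneg fun x _ => sq_nonneg _
  calc |landauPhi H (edgeChart H a) - divLinSq H a|
      ≤ C * ∑ x ∈ interiorSites H, (∑ e : LandauFree H, |gradVec H x e| * ‖a e‖ ^ 2) ^ 2 := h
    _ ≤ max C 0 * ∑ x ∈ interiorSites H, (∑ e : LandauFree H, |gradVec H x e| * ‖a e‖ ^ 2) ^ 2 :=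
        mul_le_mul_of_nonneg_right (le_max_left _ _) hS0
    _ ≤ max C 0 * (16 * (H : ℝ) ^ 4 * (64 * s ^ 4)) := mul_le_mul_of_nonneg_left hsum (le_max_right _ _)
    _ = 1024 * max C 0 * (H : ℝ) ^ 4 * s ^ 4 := by ring

/-! ## The Haar part (✓T-S5.7c), unconditionally -/

/-- **`|haarLogRatio H a| ≤ |LandauFree H|·(s²/3 + C·s⁴)` on `smallField H s`, `0 ≤ s ≤ 1`** (✓`haarTaylor`: `|log(σ(r)/σ(0)) + r²/3| ≤ C r⁴` on `[0,1]`). -/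
theorem abs_haarLogRatio_le : ∃ C : ℝ, 0 ≤ C ∧ ∀ (H : ℕ) (s : ℝ), 0 ≤ s → s ≤ 1 → ∀ a ∈ smallField H s,
    |haarLogRatio H a| ≤ Fintype.card (LandauFree H) * (s ^ 2 / 3 + C * s ^ 4) := by
  obtain ⟨C, hC⟩ := haarTaylor
  have hC0 : 0 ≤ C := by
    have h := hC 1 zero_le_one le_rfl
    have h' : (0 : ℝ) ≤ C * 1 ^ 4 := (abs_nonneg _).trans h
    simpa using h'
  refine ⟨C, hC0, fun H s hs0 hs1 a ha => ?_⟩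
  unfold haarLogRatio
  refine (Finset.abs_sum_le_sum_abs _ _).trans ?_
  have hterm : ∀ e : LandauFree H, |Real.log (sigmaSU2 ‖a e‖ / sigmaSU2 0)| ≤ s ^ 2 / 3 + C * s ^ 4 := by
    intro e
    have hr0 : 0 ≤ ‖a e‖ := norm_nonneg _
    have hrs : ‖a e‖ ≤ s := ha e
    have h := hC ‖a e‖ hr0 (hrs.trans hs1)
    have hr2 : ‖a e‖ ^ 2 ≤ s ^ 2 := pow_le_pow_left₀ hr0 hrs 2
    have hr4 : ‖a e‖ ^ 4 ≤ s ^ 4 := pow_le_pow_left₀ hr0 hrs 4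
    have h1 : |Real.log (sigmaSU2 ‖a e‖ / sigmaSU2 0)| ≤ |Real.log (sigmaSU2 ‖a e‖ / sigmaSU2 0) + ‖a e‖ ^ 2 / 3| + ‖a e‖ ^ 2 / 3 := by
      have := abs_add_le (Real.log (sigmaSU2 ‖a e‖ / sigmaSU2 0) + ‖a e‖ ^ 2 / 3) (-(‖a e‖ ^ 2 / 3))
      rw [add_neg_cancel_right, abs_neg, abs_of_nonneg (by positivity : (0:ℝ) ≤ ‖a e‖ ^ 2 / 3)] at this
      exact this
    calc |Real.log (sigmaSU2 ‖a e‖ / sigmaSU2 0)| ≤ C * ‖a e‖ ^ 4 + ‖a e‖ ^ 2 / 3 := by linarith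
      _ ≤ C * s ^ 4 + s ^ 2 / 3 := add_le_add (mul_le_mul_of_nonneg_left hr4 hC0) (by linarith)
      _ = s ^ 2 / 3 + C * s ^ 4 := by ring
  calc ∑ e : LandauFree H, |Real.log (sigmaSU2 ‖a e‖ / sigmaSU2 0)| ≤ ∑ _e : LandauFree H, (s ^ 2 / 3 + C * s ^ 4) :=
        Finset.sum_le_sum fun e _ => hterm e
    _ = Fintype.card (LandauFree H) * (s ^ 2 / 3 + C * s ^ 4) := by
        rw [Finset.sum_const, Finset.card_univ, nsmul_eq_mul]

/-! ## The ghost part: Cauchy–Schwarz for `quadVal`, and the bound GIVEN T-S5.7d -/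

/-- `Σ_i (♭a)_i² = Σ_e ‖a_e‖²`. -/
theorem sum_flat_sq (a : LandauFree H → E3) : ∑ i, flat a i ^ 2 = ∑ e, ‖a e‖ ^ 2 := by
  rw [Fintype.sum_prod_type]
  refine Finset.sum_congr rfl fun e _ => ?_
  rw [BoxQuadForm.norm_sq_eq_sum]
  rfl

/-- `Σ_e ‖a_e‖² ≤ |LandauFree H|·s²` on `smallField H s`. -/
theorem sum_norm_sq_le {s : ℝ} {a : LandauFree H → E3} (ha : a ∈ smallField H s) :
    ∑ e, ‖a e‖ ^ 2 ≤ Fintype.card (LandauFree H) * s ^ 2 := by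
  calc ∑ e, ‖a e‖ ^ 2 ≤ ∑ _e : LandauFree H, s ^ 2 := Finset.sum_le_sum fun e _ => pow_le_pow_left₀ (norm_nonneg _) (ha e) 2
    _ = Fintype.card (LandauFree H) * s ^ 2 := by rw [Finset.sum_const, Finset.card_univ, nsmul_eq_mul]

/-- **Cauchy–Schwarz for the quadratic form**: `|quadVal M a| ≤ √(Σ_{ij} M_{ij}²) · Σ_e ‖a_e‖²` (any matrix `M`). -/
theorem abs_quadVal_le (M : Matrix (LandauFree H × Fin 3) (LandauFree H × Fin 3) ℝ) (a : LandauFree H → E3) :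
    |quadVal M a| ≤ Real.sqrt (∑ i, ∑ j, M i j ^ 2) * ∑ e, ‖a e‖ ^ 2 := by
  set x := flat a with hx
  have hq : quadVal M a = ∑ p : (LandauFree H × Fin 3) × (LandauFree H × Fin 3), M p.1 p.2 * (x p.1 * x p.2) := by
    rw [quadVal, ← hx, Fintype.sum_prod_type]
    simp only [dotProduct, Matrix.mulVec, Finset.mul_sum]
    refine Finset.sum_congr rfl fun i _ => Finset.sum_congr rfl fun j _ => ?_
    ring
  have hcs := Finset.sum_mul_sq_le_sq_mul_sq (Finset.univ : Finset ((LandauFree H × Fin 3) × (LandauFree H × Fin 3)))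
    (fun p => M p.1 p.2) (fun p => x p.1 * x p.2)
  have hM : ∑ p : (LandauFree H × Fin 3) × (LandauFree H × Fin 3), (fun p => M p.1 p.2) p ^ 2 = ∑ i, ∑ j, M i j ^ 2 := by
    rw [Fintype.sum_prod_type]
  have hy : ∑ p : (LandauFree H × Fin 3) × (LandauFree H × Fin 3), (fun p => x p.1 * x p.2) p ^ 2 = (∑ i, x i ^ 2) ^ 2 := by
    rw [Fintype.sum_prod_type, sq, Finset.sum_mul_sum]
    refine Finset.sum_congr rfl fun i _ => Finset.sum_congr rfl fun j _ => ?_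
    ring
  rw [hM, hy] at hcs
  have hS0 : 0 ≤ ∑ i, x i ^ 2 := Finset.sum_nonneg fun i _ => sq_nonneg _
  have hM0 : 0 ≤ ∑ i, ∑ j, M i j ^ 2 := Finset.sum_nonneg fun i _ => Finset.sum_nonneg fun j _ => sq_nonneg _
  rw [hq, ← sum_flat_sq, ← hx]
  calc |∑ p : (LandauFree H × Fin 3) × (LandauFree H × Fin 3), M p.1 p.2 * (x p.1 * x p.2)|
      ≤ Real.sqrt ((∑ i, ∑ j, M i j ^ 2) * (∑ i, x i ^ 2) ^ 2) := Real.abs_le_sqrt hcs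
    _ = Real.sqrt (∑ i, ∑ j, M i j ^ 2) * ∑ i, x i ^ 2 := by
        rw [Real.sqrt_mul hM0, Real.sqrt_sq hS0]

/-- `√(C·H⁴·L^m) ≤ √C·H²·L^m` for `C ≥ 0`, `L ≥ 1` (`√(L^m) ≤ L^m`). -/
theorem sqrt_bound_le {C L : ℝ} (hC : 0 ≤ C) (hL : 1 ≤ L) (Hr : ℝ) (m : ℕ) :
    Real.sqrt (C * Hr ^ 4 * L ^ m) ≤ Real.sqrt C * Hr ^ 2 * L ^ m := by
  have hLm : 1 ≤ L ^ m := one_le_pow₀ hL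
  have h4 : Hr ^ 4 = (Hr ^ 2) ^ 2 := by ring
  rw [Real.sqrt_mul (by positivity), Real.sqrt_mul hC, h4, Real.sqrt_sq (by positivity)]
  refine mul_le_mul_of_nonneg_left ?_ (by positivity)
  have h0 : 0 ≤ L ^ m := by positivity
  calc Real.sqrt (L ^ m) ≤ Real.sqrt ((L ^ m) ^ 2) := Real.sqrt_le_sqrt (by nlinarith)
    _ = L ^ m := Real.sqrt_sq h0


/-- **The ghost part GIVEN T-S5.7d** (hypothesis `GhostTaylor`, verbatim): `|ghostLogRatio H a| ≤ C_g·(1+log H)^m·H⁶·(s² + s³)` on `smallField H s` whenever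
`0 ≤ s`, `s·H² ≤ c₀`, `H ≥ 1` (`|quadVal M_H a| ≤ √(ΣM²)·|LandauFree H|·s² ≤ √C·H²(1+log H)^m·216H⁴s²` plus the cubic Taylor tail). -/
theorem abs_ghostLogRatio_le_of (h7d : GhostTaylor) :
    ∃ C c₀ : ℝ, ∃ m : ℕ, 0 ≤ C ∧ 0 < c₀ ∧ ∀ H : ℕ, 1 ≤ H → ∀ s : ℝ, 0 ≤ s → s * (H : ℝ) ^ 2 ≤ c₀ → ∀ a ∈ smallField H s,
      |ghostLogRatio H a| ≤ C * (1 + Real.log H) ^ m * (H : ℝ) ^ 6 * (s ^ 2 + s ^ 3) := by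
  obtain ⟨C, c₀, m, hc₀, hG⟩ := h7d
  refine ⟨max C 0 + 216 * Real.sqrt (max C 0), c₀, m, by positivity, hc₀, fun H hH s hs0 hsH a ha => ?_⟩
  obtain ⟨M, hM, hT⟩ := hG H hH
  have hrem : |ghostLogRatio H a - quadVal M a| ≤ C * (H : ℝ) ^ 6 * (1 + Real.log H) ^ m * s ^ 3 := hT s a hs0 hsH ha
  have hH1 : (1 : ℝ) ≤ H := by exact_mod_cast hH
  have hL : 1 ≤ 1 + Real.log H := by have := Real.log_nonneg hH1; linarith
  have hLm : 1 ≤ (1 + Real.log (H : ℝ)) ^ m := one_le_pow₀ hL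
  have hX0 : 0 ≤ (H : ℝ) ^ 4 * (1 + Real.log H) ^ m := by positivity
  have hM' : ∑ i, ∑ j, M i j ^ 2 ≤ max C 0 * (H : ℝ) ^ 4 * (1 + Real.log H) ^ m := by
    refine hM.trans ?_
    rw [mul_assoc, mul_assoc]
    exact mul_le_mul_of_nonneg_right (le_max_left _ _) hX0
  have hsq : Real.sqrt (∑ i, ∑ j, M i j ^ 2) ≤ Real.sqrt (max C 0) * (H : ℝ) ^ 2 * (1 + Real.log H) ^ m :=
    (Real.sqrt_le_sqrt hM').trans (sqrt_bound_le (le_max_right _ _) hL (H : ℝ) m)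
  have hsum0 := sum_norm_sq_le ha
  have hcard := SmallFieldFP.card_landauFree_le (H := H) hH
  have hsumH : ∑ e, ‖a e‖ ^ 2 ≤ 216 * (H : ℝ) ^ 4 * s ^ 2 :=
    hsum0.trans (mul_le_mul_of_nonneg_right hcard (sq_nonneg _))
  have hq : |quadVal M a| ≤ Real.sqrt (max C 0) * (H : ℝ) ^ 2 * (1 + Real.log H) ^ m * (216 * (H : ℝ) ^ 4 * s ^ 2) :=
    (abs_quadVal_le M a).trans (mul_le_mul hsq hsumH (Finset.sum_nonneg fun e _ => sq_nonneg _) (by positivity))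
  have hrem' : |ghostLogRatio H a - quadVal M a| ≤ max C 0 * (H : ℝ) ^ 6 * (1 + Real.log H) ^ m * s ^ 3 := by
    refine hrem.trans ?_
    have h0 : 0 ≤ (H : ℝ) ^ 6 * (1 + Real.log H) ^ m * s ^ 3 := by positivity
    calc C * (H : ℝ) ^ 6 * (1 + Real.log H) ^ m * s ^ 3 = C * ((H : ℝ) ^ 6 * (1 + Real.log H) ^ m * s ^ 3) := by ring
      _ ≤ max C 0 * ((H : ℝ) ^ 6 * (1 + Real.log H) ^ m * s ^ 3) := mul_le_mul_of_nonneg_right (le_max_left _ _) h0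
      _ = _ := by ring
  have hsplit : |ghostLogRatio H a| ≤ |ghostLogRatio H a - quadVal M a| + |quadVal M a| := by
    have := abs_add_le (ghostLogRatio H a - quadVal M a) (quadVal M a)
    rwa [sub_add_cancel] at this
  refine hsplit.trans ((add_le_add hrem' hq).trans ?_)
  have hx1 : 0 ≤ max C 0 * (1 + Real.log H) ^ m * (H : ℝ) ^ 6 * s ^ 2 := by positivity
  have hx2 : 0 ≤ 216 * Real.sqrt (max C 0) * (1 + Real.log H) ^ m * (H : ℝ) ^ 6 * s ^ 3 := by positivity
  have e : (max C 0 + 216 * Real.sqrt (max C 0)) * (1 + Real.log H) ^ m * (H : ℝ) ^ 6 * (s ^ 2 + s ^ 3) =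
      (max C 0 * (H : ℝ) ^ 6 * (1 + Real.log H) ^ m * s ^ 3 +
        Real.sqrt (max C 0) * (H : ℝ) ^ 2 * (1 + Real.log H) ^ m * (216 * (H : ℝ) ^ 4 * s ^ 2)) +
      (max C 0 * (1 + Real.log H) ^ m * (H : ℝ) ^ 6 * s ^ 2 + 216 * Real.sqrt (max C 0) * (1 + Real.log H) ^ m * (H : ℝ) ^ 6 * s ^ 3) := by
    ring
  linarith

/-! ## The package: `sup_D |tiltU|` -/

/-- **ASSEMBLY-S5 §5, the sup bound on the tilt exponent, GIVEN T-S5.7d** (`GhostTaylor`, verbatim; everything else by name from the tree):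
there are `C`, `c₀ > 0`, `m` such that for all `H ≥ 1`, all `β`, all `0 ≤ s ≤ 1` with `s·H² ≤ c₀`, and all `a ∈ smallField H s`,
`|tiltU β H a| ≤ C·(1 + log H)^m·(|β|·H⁴·s³ + H⁶·s²)`.  (In the assembly `s = β^{−1/2+κ₃}`, `H = ⌈β^θ⌉`: `|β|H⁴s³ = β^{4θ−1/2+3κ₃} → 0`,
`H⁶s² = β^{6θ−1+2κ₃} → 0`, so `sup_D |U| ≤ 1` for `β ≥ β₀`.) -/
theorem abs_tiltU_le_of (h7d : GhostTaylor) :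
    ∃ C c₀ : ℝ, ∃ m : ℕ, 0 < c₀ ∧ ∀ H : ℕ, 1 ≤ H → ∀ β s : ℝ, 0 ≤ s → s ≤ 1 → s * (H : ℝ) ^ 2 ≤ c₀ →
      ∀ a ∈ smallField H s, |tiltU β H a| ≤ C * (1 + Real.log H) ^ m * (|β| * (H : ℝ) ^ 4 * s ^ 3 + (H : ℝ) ^ 6 * s ^ 2) := by
  obtain ⟨Cg, c₀, m, hCg, hc₀, hg⟩ := abs_ghostLogRatio_le_of h7d
  obtain ⟨CΦ, hCΦ, hΦ⟩ := abs_landauPhi_sub_divLinSq_le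
  obtain ⟨Ch, hCh, hh⟩ := abs_haarLogRatio_le
  refine ⟨409600 + CΦ + 2 * Cg + 216 * (1 / 3 + Ch), c₀, m, hc₀, fun H hH β s hs0 hs1 hsH a ha => ?_⟩
  -- atoms
  set A := |β| * (H : ℝ) ^ 4 * s ^ 3 with hA
  set B := (H : ℝ) ^ 6 * s ^ 2 with hB
  set L := (1 + Real.log (H : ℝ)) ^ m with hLdef
  have hH1 : (1 : ℝ) ≤ H := by exact_mod_cast hH
  have hL1 : 1 ≤ L := one_le_pow₀ (by have := Real.log_nonneg hH1; linarith)
  have hA0 : 0 ≤ A := by positivity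
  have hB0 : 0 ≤ B := by positivity
  have hs43 : s ^ 4 ≤ s ^ 3 := pow_le_pow_of_le_one hs0 hs1 (by norm_num)
  have hs32 : s ^ 3 ≤ s ^ 2 := pow_le_pow_of_le_one hs0 hs1 (by norm_num)
  have hH46 : (H : ℝ) ^ 4 ≤ (H : ℝ) ^ 6 := pow_le_pow_right₀ hH1 (by norm_num)
  -- the four pieces
  have h1 : |cubicVertex β H a + quarticWilson β H a| ≤ 409600 * A := by
    rw [hA, ← mul_assoc, ← mul_assoc]; exact abs_cubicVertex_add_quarticWilson_le hH β hs0 hs1 ha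
  have h2 : |β * (landauPhi H (edgeChart H a) - divLinSq H a)| ≤ CΦ * A := by
    rw [abs_mul]
    calc |β| * |landauPhi H (edgeChart H a) - divLinSq H a| ≤ |β| * (CΦ * (H : ℝ) ^ 4 * s ^ 4) :=
          mul_le_mul_of_nonneg_left (hΦ H hH s a ha) (abs_nonneg _)
      _ ≤ |β| * (CΦ * (H : ℝ) ^ 4 * s ^ 3) := by gcongr
      _ = CΦ * A := by rw [hA]; ring
  have h3 : |ghostLogRatio H a| ≤ 2 * Cg * L * B := by
    calc |ghostLogRatio H a| ≤ Cg * L * (H : ℝ) ^ 6 * (s ^ 2 + s ^ 3) := by rw [hLdef]; exact hg H hH s hs0 hsH a ha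
      _ ≤ Cg * L * (H : ℝ) ^ 6 * (s ^ 2 + s ^ 2) := by gcongr
      _ = 2 * Cg * L * B := by rw [hB]; ring
  have h4 : |haarLogRatio H a| ≤ 216 * (1 / 3 + Ch) * B := by
    have hcard := SmallFieldFP.card_landauFree_le (H := H) hH
    calc |haarLogRatio H a| ≤ Fintype.card (LandauFree H) * (s ^ 2 / 3 + Ch * s ^ 4) := hh H s hs0 hs1 a ha
      _ ≤ 216 * (H : ℝ) ^ 4 * (s ^ 2 / 3 + Ch * s ^ 4) := mul_le_mul_of_nonneg_right hcard (by positivity)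
      _ ≤ 216 * (H : ℝ) ^ 6 * (s ^ 2 / 3 + Ch * s ^ 2) := by
          have hXY : s ^ 2 / 3 + Ch * s ^ 4 ≤ s ^ 2 / 3 + Ch * s ^ 2 := by
            have := mul_le_mul_of_nonneg_left (hs43.trans hs32) hCh
            linarith
          exact mul_le_mul (mul_le_mul_of_nonneg_left hH46 (by norm_num)) hXY (by positivity) (by positivity)
      _ = 216 * (1 / 3 + Ch) * B := by rw [hB]; ring
  -- triangle inequality on `tiltU = −(V₃ + W₄) − β(Φ − divLinSq) + ghost + Haar`
  have htri : |tiltU β H a| ≤ |cubicVertex β H a + quarticWilson β H a| + |β * (landauPhi H (edgeChart H a) - divLinSq H a)| +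
      |ghostLogRatio H a| + |haarLogRatio H a| := by
    have e : tiltU β H a = -(cubicVertex β H a + quarticWilson β H a) + -(β * (landauPhi H (edgeChart H a) - divLinSq H a)) +
        ghostLogRatio H a + haarLogRatio H a := by rw [tiltU]; ring
    rw [e]
    calc |-(cubicVertex β H a + quarticWilson β H a) + -(β * (landauPhi H (edgeChart H a) - divLinSq H a)) +
            ghostLogRatio H a + haarLogRatio H a|
        ≤ |-(cubicVertex β H a + quarticWilson β H a) + -(β * (landauPhi H (edgeChart H a) - divLinSq H a)) +
            ghostLogRatio H a| + |haarLogRatio H a| := abs_add_le _ _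
      _ ≤ |-(cubicVertex β H a + quarticWilson β H a) + -(β * (landauPhi H (edgeChart H a) - divLinSq H a))| +
            |ghostLogRatio H a| + |haarLogRatio H a| := by gcongr; exact abs_add_le _ _
      _ ≤ |-(cubicVertex β H a + quarticWilson β H a)| + |-(β * (landauPhi H (edgeChart H a) - divLinSq H a))| +
            |ghostLogRatio H a| + |haarLogRatio H a| := by gcongr; exact abs_add_le _ _
      _ = _ := by rw [abs_neg, abs_neg]
  have hsum : |tiltU β H a| ≤ 409600 * A + CΦ * A + 2 * Cg * L * B + 216 * (1 / 3 + Ch) * B := by linarith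
  refine hsum.trans ?_
  have hAL : A ≤ L * A := le_mul_of_one_le_left hA0 hL1
  have hBL : B ≤ L * B := le_mul_of_one_le_left hB0 hL1
  nlinarith [mul_nonneg hCΦ hA0, mul_nonneg hCg hB0, mul_nonneg hCh hB0, mul_nonneg (mul_nonneg hCΦ hA0) (sub_nonneg.2 hL1),
    mul_nonneg (mul_nonneg hCh hB0) (sub_nonneg.2 hL1)]

end TiltSup

end Summit.QuantumFields.YangMills.Theorems.AllWindowsColdBoxBoxHighLine
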